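import Mathlib.Analysis.InnerProductSpace.Projection.Basic
import Mathlib.Analysis.InnerProductSpace.Symmetric
import HarnessLib

/-!
# An eigenvector with simple eigenvalue lies inside a reducing subspace or inside its complement

Topic `Literature/Analysis/InnerProduct` (companion of `SubspaceLeakage`, `NearNullLeakage`).
Setting: an inner product space `E` over `𝕜 = ℝ` or `ℂ`; a linear map `T`; a subspace `W` carrying
Mathlib's orthogonal projection `P_W = W.starProjection`; an eigenvector `T u = ε u`; `p = P_W u`,
`q = u − p`.

EXACT HALF (reducing subspaces: Kato, *Perturbation theory for linear operators* (1966), I-§3.5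
"Invariance. Decomposition" — `T` is decomposed (reduced) by a pair of complementary invariant
subspaces and then commutes with the projection —, III-§5.6 (5.23)–(5.24), V-§3.9 (3.34) "a symmetric
`T` is reduced by `M` iff it commutes with the orthogonal projection on `M` iff it is reduced by `M^⊥`";
the transported spectral subspace `U(a) M(0) = M(a) = P(a) H` of a holomorphic symmetric family is such
an `M` at every parameter: II-§4.2 (4.7)–(4.9), II-§6.2):
* `apply_mem_orthogonal_of_isSymmetric` — for symmetric `T`, a `T`-invariant `W` has `T`-invariant `Wᗮ`.
* `apply_starProjection_of_invariant` — if `W` and `Wᗮ` are `T`-invariant then `P_W` maps the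
  eigenvector `u` to an eigenvector: `T p = ε p` (because `T p − ε p` lies in `W ∩ Wᗮ = 0`).
* `mem_or_mem_orthogonal_of_eigenvector` — THE DICHOTOMY: if moreover `ε` is simple
  (`T v = ε v → v ∈ 𝕜 u`) then `u ∈ W` or `u ∈ Wᗮ`; `starProjection_eq_self_or_eq_zero_of_eigenvector`
  — equivalently `P_W u = u` or `P_W u = 0`: the "capture" `‖P_W u‖ / ‖u‖` of a simple eigenvector by a
  reducing subspace is exactly `1` or exactly `0`, never a tolerance statement.
QUANTITATIVE HALF (approximately reducing subspaces; the `sin 2Θ` shape of Davis–Kahan 1970, §2,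
recorded in the one-line eigenvector form we use; elementary):
* `apply_starProjection_sub_smul_eq` — the REDUCING DEFECT of `p`: `T p − ε p = (1 − P_W) T p − P_W T q`,
  the two off-diagonal blocks of `T` applied to `p` and `q`; in particular it vanishes when `W, Wᗮ`
  are invariant, and in general it is at most `‖(1 − P_W) T P_W‖ ‖p‖ + ‖P_W T (1 − P_W)‖ ‖q‖`.
* `mul_norm_starProjection_mul_norm_sub_le` — for a UNIT eigenvector whose eigenvalue is isolated on
  `uᗮ` with gap `γ` (`⟪u, x⟫ = 0 → γ ‖x‖ ≤ ‖T x − ε x‖`):  `γ · ‖p‖ ‖q‖ ≤ ‖T p − ε p‖`, i.e.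
  `½ sin 2θ ≤ defect / gap` with `cos θ = ‖p‖`, `sin θ = ‖q‖`; proof: `p − ‖p‖² u ⊥ u` has the same
  defect as `p` and norm `‖p‖ ‖q‖`.  `norm_starProjection_mul_norm_sub_le_div` is the divided form.
  With defect `0` and `γ > 0` it returns the dichotomy (`‖p‖ ‖q‖ = 0`).

Motivation (pub-rhpf cell, THEORY-3 "the intruder mode past a* is orthogonal to the transported
prolate span"; mechanism/rigidity campaign, no RH claims): the Kato transport of a spectral subspace
of a symmetric analytic family is again a spectral subspace, hence REDUCING, so "crossing eigenvector
⟂ transported span" is exactly true or exactly false for ANY symmetric window family (decided by the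
branch bookkeeping, not by arithmetic), and an approximately transported span captures a gapped
eigenvector up to `sin 2θ ≤ 2·defect/gap`. Abstract linear algebra only; no definitions, no named
facts; sorry-free.

## References
* T. Kato, *Perturbation Theory for Linear Operators*, Grundlehren 132, Springer (1966), I-§3.5,
  III-§5.6 eq. (5.23)–(5.24), V-§3.9 eq. (3.34); II-§4.2 eq. (4.7)–(4.9), II-§6.2. [Kato1966]
* C. Davis, W. M. Kahan, The rotation of eigenvectors by a perturbation III, SIAM J. Numer. Anal. 7
  (1970) 1–46 (the `sin 2Θ` and `tan 2Θ` theorems). [DavisKahan1970]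
* S. Albeverio, A. K. Motovilov, A. V. Selin, The a priori tan Θ theorem for eigenvectors, SIAM J.
  Matrix Anal. Appl. 29 (2007) 685–697, arXiv:math/0512545, eq. (1.4)–(1.5) (the angle between an
  eigenvector of `A + V` and a spectral subspace of `A` is at most `½ arctan (2‖V‖/d)`).
* G. H. Golub, C. F. Van Loan, *Matrix Computations*, 4th ed. (2013), §8.1.3 (invariant subspaces,
  Thm 8.1.10–8.1.13). [GolubVanLoan2013]
-/

noncomputable section

open scoped InnerProductSpace

namespace Literature.Analysis.InnerProduct

variable {𝕜 : Type*} [RCLike 𝕜] {E : Type*} [NormedAddCommGroup E] [InnerProductSpace 𝕜 E]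

section Exact

/-- For a symmetric `T`, the orthogonal complement of a `T`-invariant subspace is `T`-invariant
(so an invariant `W` with an orthogonal projection REDUCES `T`). [cite: Kato1966, V-§3.9 (3.34)] -/
theorem apply_mem_orthogonal_of_isSymmetric {T : E →ₗ[𝕜] E} (hT : T.IsSymmetric)
    (W : Submodule 𝕜 E) (hW : ∀ w ∈ W, T w ∈ W) {x : E} (hx : x ∈ Wᗮ) : T x ∈ Wᗮ := by
  rw [Submodule.mem_orthogonal]
  intro v hv
  rw [← hT v x]
  exact Submodule.inner_right_of_mem_orthogonal (hW v hv) hx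

/-- **Reducing subspaces preserve eigenvectors.** If `W` and `Wᗮ` are both `T`-invariant and
`T u = ε u` then `T (P_W u) = ε (P_W u)`: the vector `T p − ε p` lies in `W` and in `Wᗮ`.
(`T` commutes with `P_W` on a reducing pair, Kato I-§3.5, III-(5.24).) [cite: Kato1966, I-§3.5; III-§5.6 (5.24)] -/
theorem apply_starProjection_of_invariant {T : E →ₗ[𝕜] E} (W : Submodule 𝕜 E)
    [W.HasOrthogonalProjection] (hW : ∀ w ∈ W, T w ∈ W) (hW' : ∀ w ∈ Wᗮ, T w ∈ Wᗮ)
    {u : E} {ε : 𝕜} (hu : T u = ε • u) :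
    T (W.starProjection u) = ε • W.starProjection u := by
  set p := W.starProjection u with hp_def
  have hpW : p ∈ W := W.starProjection_apply_mem u
  have hqW : u - p ∈ Wᗮ := W.sub_starProjection_mem_orthogonal u
  have hA : T p - ε • p ∈ W := W.sub_mem (hW p hpW) (W.smul_mem _ hpW)
  have hB : T p - ε • p ∈ Wᗮ := by
    have h1 : T (u - p) - ε • (u - p) ∈ Wᗮ := Wᗮ.sub_mem (hW' _ hqW) (Wᗮ.smul_mem _ hqW)
    have h2 : T p - ε • p = -(T (u - p) - ε • (u - p)) := by
      rw [map_sub, hu, smul_sub]; abel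
    rw [h2]
    exact Wᗮ.neg_mem h1
  have h0 : T p - ε • p = 0 := by
    have h : ⟪T p - ε • p, T p - ε • p⟫_𝕜 = 0 := Submodule.inner_right_of_mem_orthogonal hA hB
    exact inner_self_eq_zero.mp h
  exact sub_eq_zero.mp h0

/-- **The dichotomy.** An eigenvector `u` whose eigenvalue `ε` is simple (`T v = ε v` forces
`v ∈ 𝕜 u`) lies inside every reducing subspace `W` (both `W` and `Wᗮ` invariant) or inside `Wᗮ`:
"`u ⟂ W`" is exactly true or exactly false, never a tolerance statement.
[cite: Kato1966, I-§3.5; V-§3.9] -/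
theorem mem_or_mem_orthogonal_of_eigenvector {T : E →ₗ[𝕜] E} (W : Submodule 𝕜 E)
    [W.HasOrthogonalProjection] (hW : ∀ w ∈ W, T w ∈ W) (hW' : ∀ w ∈ Wᗮ, T w ∈ Wᗮ)
    {u : E} {ε : 𝕜} (hu : T u = ε • u) (hsimple : ∀ v : E, T v = ε • v → ∃ c : 𝕜, v = c • u) :
    u ∈ W ∨ u ∈ Wᗮ := by
  set p := W.starProjection u with hp_def
  have hpW : p ∈ W := W.starProjection_apply_mem u
  have hqW : u - p ∈ Wᗮ := W.sub_starProjection_mem_orthogonal u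
  obtain ⟨c, hc⟩ := hsimple p (apply_starProjection_of_invariant W hW hW' hu)
  by_cases hc0 : c = 0
  · right
    have hp0 : p = 0 := by rw [hc, hc0, zero_smul]
    simpa [hp0] using hqW
  · left
    have : u = c⁻¹ • p := by rw [hc, smul_smul, inv_mul_cancel₀ hc0, one_smul]
    rw [this]
    exact W.smul_mem _ hpW

/-- The dichotomy in projection form: `P_W u = u` or `P_W u = 0` — the capture `‖P_W u‖ / ‖u‖` of a
simple eigenvector by a reducing subspace is exactly `1` or exactly `0`.
[cite: Kato1966, I-§3.5; V-§3.9] -/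
theorem starProjection_eq_self_or_eq_zero_of_eigenvector {T : E →ₗ[𝕜] E} (W : Submodule 𝕜 E)
    [W.HasOrthogonalProjection] (hW : ∀ w ∈ W, T w ∈ W) (hW' : ∀ w ∈ Wᗮ, T w ∈ Wᗮ)
    {u : E} {ε : 𝕜} (hu : T u = ε • u) (hsimple : ∀ v : E, T v = ε • v → ∃ c : 𝕜, v = c • u) :
    W.starProjection u = u ∨ W.starProjection u = 0 := by
  rcases mem_or_mem_orthogonal_of_eigenvector W hW hW' hu hsimple with h | h
  · exact Or.inl (Submodule.starProjection_eq_self_iff.mpr h)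
  · exact Or.inr ((Submodule.starProjection_apply_eq_zero_iff W).mpr h)

end Exact

section Quantitative

/-- **Reducing defect of the projected eigenvector.** For `T u = ε u`, `p = P_W u`, `q = u − p`:
`T p − ε p = (T p − P_W (T p)) − P_W (T q)` — the two off-diagonal blocks `(1 − P_W) T P_W` and
`P_W T (1 − P_W)` of `T` applied to `u`; so `‖T p − ε p‖ ≤ ‖(1 − P_W) T p‖ + ‖P_W T q‖`, and the defect
vanishes on a reducing pair. [cite: GolubVanLoan2013, §8.1.3 Thm 8.1.10 (block form)] -/
theorem apply_starProjection_sub_smul_eq {T : E →ₗ[𝕜] E} (W : Submodule 𝕜 E)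
    [W.HasOrthogonalProjection] {u : E} {ε : 𝕜} (hu : T u = ε • u) :
    T (W.starProjection u) - ε • W.starProjection u
      = (T (W.starProjection u) - W.starProjection (T (W.starProjection u)))
        - W.starProjection (T (u - W.starProjection u)) := by
  have h1 : W.starProjection (T (u - W.starProjection u))
      = ε • W.starProjection u - W.starProjection (T (W.starProjection u)) := by
    rw [map_sub, map_sub, hu, map_smul]
  rw [h1]
  abel

/-- **`sin 2θ` bound.** Let `u` be a UNIT eigenvector, `T u = ε u`, whose eigenvalue is isolated on
`uᗮ` with gap `γ`: `⟪u, x⟫ = 0 → γ ‖x‖ ≤ ‖T x − ε x‖`. Then for every subspace `W`,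
`γ · ‖P_W u‖ · ‖u − P_W u‖ ≤ ‖T (P_W u) − ε P_W u‖` (cos θ · sin θ ≤ defect / gap). No symmetry of `T`
and no sign of `γ` is used. Proof: `p − ‖p‖² u` is orthogonal to `u`, has the same defect as `p`, and
has norm `‖p‖ ‖u − p‖`. [cite: DavisKahan1970, sin 2Θ theorem (one-vector a-posteriori form)] -/
theorem mul_norm_starProjection_mul_norm_sub_le {T : E →ₗ[𝕜] E} (W : Submodule 𝕜 E)
    [W.HasOrthogonalProjection] {u : E} {ε : 𝕜} (hu : T u = ε • u) (hu1 : ‖u‖ = 1) {γ : ℝ}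
    (hgap : ∀ x : E, ⟪u, x⟫_𝕜 = 0 → γ * ‖x‖ ≤ ‖T x - ε • x‖) :
    γ * (‖W.starProjection u‖ * ‖u - W.starProjection u‖)
      ≤ ‖T (W.starProjection u) - ε • W.starProjection u‖ := by
  set p := W.starProjection u with hp_def
  set r : ℝ := ‖p‖ ^ 2 with hr_def
  have hpW : p ∈ W := W.starProjection_apply_mem u
  have hqW : u - p ∈ Wᗮ := W.sub_starProjection_mem_orthogonal u
  -- ⟪u, p⟫ = ‖p‖² (as an element of 𝕜)
  have hup : ⟪u, p⟫_𝕜 = (r : 𝕜) := by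
    have hsplit : u = p + (u - p) := by abel
    rw [hsplit, inner_add_left, Submodule.inner_left_of_mem_orthogonal hpW hqW, add_zero,
      inner_self_eq_norm_sq_to_K, hr_def]
    push_cast
    rfl
  -- Pythagoras for the unit vector `u`: ‖p‖² + ‖u − p‖² = 1
  have hpyth : ‖p‖ ^ 2 + ‖u - p‖ ^ 2 = 1 := by
    have h := W.norm_sq_eq_add_norm_sq_starProjection u
    rw [Submodule.starProjection_orthogonal_val, hu1, one_pow] at h
    exact h.symm
  -- the auxiliary vector `p' = p − r u`
  set p' := p - (r : 𝕜) • u with hp'_def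
  have horth : ⟪u, p'⟫_𝕜 = 0 := by
    rw [hp'_def, inner_sub_right, inner_smul_right, hup, inner_self_eq_norm_sq_to_K, hu1]
    simp
  have hres : T p' - ε • p' = T p - ε • p := by
    rw [hp'_def, map_sub, map_smul, hu, smul_sub, smul_smul, smul_smul, mul_comm ε (r : 𝕜)]
    abel
  -- ‖p'‖ = ‖p‖ ‖u − p‖
  have hnorm_sq : ‖p'‖ ^ 2 = (‖p‖ * ‖u - p‖) ^ 2 := by
    have h1 : ‖p'‖ ^ 2 = ‖p‖ ^ 2 - 2 * RCLike.re ⟪p, (r : 𝕜) • u⟫_𝕜 + ‖(r : 𝕜) • u‖ ^ 2 :=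
      @norm_sub_sq 𝕜 _ _ _ _ p ((r : 𝕜) • u)
    have h2 : RCLike.re ⟪p, (r : 𝕜) • u⟫_𝕜 = r * r := by
      rw [inner_smul_right, ← inner_conj_symm, hup, RCLike.conj_ofReal]
      rw [← RCLike.ofReal_mul, RCLike.ofReal_re]
    have h3 : ‖(r : 𝕜) • u‖ = r := by
      rw [norm_smul, hu1, mul_one, RCLike.norm_ofReal, hr_def, abs_of_nonneg (sq_nonneg _)]
    rw [h1, h2, h3]
    have hq : ‖u - p‖ ^ 2 = 1 - r := by rw [hr_def]; linarith
    rw [mul_pow, hq, hr_def]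
    ring
  have hnorm : ‖p'‖ = ‖p‖ * ‖u - p‖ :=
    (pow_left_inj₀ (norm_nonneg _) (mul_nonneg (norm_nonneg _) (norm_nonneg _)) two_ne_zero).1
      hnorm_sq
  calc γ * (‖p‖ * ‖u - p‖) = γ * ‖p'‖ := by rw [hnorm]
    _ ≤ ‖T p' - ε • p'‖ := hgap p' horth
    _ = ‖T p - ε • p‖ := by rw [hres]

/-- **`sin 2θ` bound, divided form.** Unit eigenvector `T u = ε u`, gap `γ > 0` on `uᗮ`, and reducing
defect `‖T (P_W u) − ε P_W u‖ ≤ η` give `‖P_W u‖ · ‖u − P_W u‖ ≤ η / γ`; with `η = 0` (a reducing pair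
`W, Wᗮ`) this is the exact dichotomy `P_W u = 0 ∨ P_W u = u`. [cite: DavisKahan1970, sin 2Θ theorem] -/
theorem norm_starProjection_mul_norm_sub_le_div {T : E →ₗ[𝕜] E} (W : Submodule 𝕜 E)
    [W.HasOrthogonalProjection] {u : E} {ε : 𝕜} (hu : T u = ε • u) (hu1 : ‖u‖ = 1) {γ η : ℝ}
    (hγ : 0 < γ) (hgap : ∀ x : E, ⟪u, x⟫_𝕜 = 0 → γ * ‖x‖ ≤ ‖T x - ε • x‖)
    (hη : ‖T (W.starProjection u) - ε • W.starProjection u‖ ≤ η) :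
    ‖W.starProjection u‖ * ‖u - W.starProjection u‖ ≤ η / γ := by
  rw [le_div_iff₀ hγ, mul_comm]
  exact (mul_norm_starProjection_mul_norm_sub_le W hu hu1 hgap).trans hη

end Quantitative

end Literature.Analysis.InnerProduct

end
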